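import Mathlib
import HarnessLib
import Literature.Geometry.DiscreteGeometry.KissingNodeDegree

/-!
# No closed 4-cycle of short steps among four well-separated directions on a circle

Route `PricedLinkCensus`, item `SoftFourRings` (stmt-AtomisticToContinuum-14234), blueprint step 3(A)
(evidence `softrings-search.md` §7): the metric lemma behind "no link vertex has four triangular
corners" — five of the twelve exotic 4-regular planar link types (those with a (3,3,3,3) vertex,
and the two octahedra) die by it.

Pure circle geometry.  Four angles `θ₀, …, θ₃ ∈ (−π, π]` (the tangent directions of the four
link-neighbours of a site) such that every two differ by at least `g₀` on the circle
(`cos (θ i − θ j) ≤ cos g₀`) cannot close up a 4-cycle of steps of circular length `≤ g₁`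
(`cos (θ (k+1) − θ k) ≥ cos g₁`, indices mod 4) as soon as `π/3 < g₀ ≤ g₁ < π/2`, `2 g₀ ≤ π`
and `g₁ < 2 g₀`: sorted around the circle the four gaps are `≥ g₀`, a bonded pair must be
sorted-adjacent (two gaps already exceed `g₁`), so the 4-cycle is the sorted cycle and
`2π = Σ gaps ≤ 4 g₁ < 2π`.  At tolerance `η = 1/100` the soft-link window gives `g₀ = 68.6°`,
`g₁ = 72.4°`.

Modelled on `Literature/Geometry/DiscreteGeometry/KissingNodeDegree.lean` (Hales 2012, Lemma 7:
five gaps), whose sorting device (`Finset.orderEmbOfFin`) is reused.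
-/

namespace Summit.AtomisticToContinuum.Crystallization.Theorems

open Real

/-- `cos (a − b) = cos (b − a)`. [folklore] -/
theorem cos_sub_rev (a b : ℝ) : cos (a - b) = cos (b - a) := by
  rw [← cos_neg, neg_sub]

/-- From `cos x ≤ cos g` with `0 ≤ x` and `g ≤ π`: `g ≤ x`. [folklore] -/
theorem le_of_cos_le_cos {x g : ℝ} (hx0 : 0 ≤ x) (hgπ : g ≤ π) (h : cos x ≤ cos g) : g ≤ x := by
  rcases le_or_gt g x with h' | hlt
  · exact h'
  · have := cos_lt_cos_of_nonneg_of_le_pi hx0 hgπ hlt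
    linarith

/-- From `cos g ≤ cos x` with `x ≤ π` and `0 ≤ g`: `x ≤ g`. [folklore] -/
theorem le_of_cos_le_cos' {x g : ℝ} (hxπ : x ≤ π) (hg0 : 0 ≤ g) (h : cos g ≤ cos x) : x ≤ g := by
  rcases le_or_gt x g with h' | hlt
  · exact h'
  · have := cos_lt_cos_of_nonneg_of_le_pi hg0 hxπ hlt
    linarith

/-- **Four sorted directions: the gap bookkeeping.**  `t₀ < t₁ < t₂ < t₃` in `(−π, π]` with all
pairwise circular distances `≥ g₀` (`cos (t i − t j) ≤ cos g₀`, `π/3 < g₀`, `2g₀ ≤ π`): the three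
gaps and the wrap-around gap are `≥ g₀` and `≤ 2π − 3 g₀ < π`, and the two "diagonal"
differences `t₂ − t₀`, `t₃ − t₁` have cosine `≤ cos (2 g₀)`. [folklore] -/
theorem four_sorted_gaps {g₀ : ℝ} (hg₀ : π / 3 < g₀) (h2g₀ : 2 * g₀ ≤ π) (t : Fin 4 → ℝ)
    (hmono : StrictMono t) (hlo : -π < t 0) (hhi : t 3 ≤ π)
    (hsep : ∀ i j, i ≠ j → cos (t i - t j) ≤ cos g₀) :
    g₀ ≤ t 1 - t 0 ∧ g₀ ≤ t 2 - t 1 ∧ g₀ ≤ t 3 - t 2 ∧ t 3 - t 0 ≤ 2 * π - g₀ ∧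
      cos (t 2 - t 0) ≤ cos (2 * g₀) ∧ cos (t 3 - t 1) ≤ cos (2 * g₀) := by
  have hπ := pi_pos
  have h01 : t 0 < t 1 := hmono (by decide)
  have h12 : t 1 < t 2 := hmono (by decide)
  have h23 : t 2 < t 3 := hmono (by decide)
  have hg₀π : g₀ ≤ π := by linarith
  -- a difference in `(0, 2π)` with `cos ≤ cos g₀` is in `[g₀, 2π - g₀]`
  have key : ∀ x : ℝ, 0 < x → x < 2 * π → cos x ≤ cos g₀ → g₀ ≤ x ∧ x ≤ 2 * π - g₀ := by
    intro x hx0 hx2 hc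
    rcases le_or_gt x π with hxπ | hxπ
    · exact ⟨le_of_cos_le_cos hx0.le hg₀π hc, by linarith⟩
    · have hc' : cos (2 * π - x) ≤ cos g₀ := by rwa [cos_two_pi_sub]
      have := le_of_cos_le_cos (by linarith) hg₀π hc'
      exact ⟨by linarith, by linarith⟩
  have hs10 := hsep 1 0 (by decide)
  have hs21 := hsep 2 1 (by decide)
  have hs32 := hsep 3 2 (by decide)
  have hs30 := hsep 3 0 (by decide)
  obtain ⟨g1lo, -⟩ := key (t 1 - t 0) (by linarith) (by linarith) hs10
  obtain ⟨g2lo, -⟩ := key (t 2 - t 1) (by linarith) (by linarith) hs21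
  obtain ⟨g3lo, -⟩ := key (t 3 - t 2) (by linarith) (by linarith) hs32
  obtain ⟨-, g30hi⟩ := key (t 3 - t 0) (by linarith) (by linarith) hs30
  refine ⟨g1lo, g2lo, g3lo, g30hi, ?_, ?_⟩
  · -- `t 2 - t 0 ∈ [2 g₀, 2π - 2 g₀]`
    have hlo2 : 2 * g₀ ≤ t 2 - t 0 := by linarith
    have hhi2 : t 2 - t 0 ≤ 2 * π - 2 * g₀ := by linarith
    rcases le_or_gt (t 2 - t 0) π with hxπ | hxπ
    · exact cos_le_cos_of_nonneg_of_le_pi (by linarith) hxπ hlo2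
    · rw [← cos_two_pi_sub]
      exact cos_le_cos_of_nonneg_of_le_pi (by linarith) (by linarith) (by linarith)
  · have hlo2 : 2 * g₀ ≤ t 3 - t 1 := by linarith
    have hhi2 : t 3 - t 1 ≤ 2 * π - 2 * g₀ := by linarith
    rcases le_or_gt (t 3 - t 1) π with hxπ | hxπ
    · exact cos_le_cos_of_nonneg_of_le_pi (by linarith) hxπ hlo2
    · rw [← cos_two_pi_sub]
      exact cos_le_cos_of_nonneg_of_le_pi (by linarith) (by linarith) (by linarith)

/-- The combinatorial heart: four pairwise distinct elements `a, b, c, d` of `Fin 4` (= ℤ/4) such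
that neither `{a, c}` nor `{b, d}` is a pair of cyclically consecutive residues; then all of
`{a,b}, {b,c}, {c,d}, {d,a}` are. [folklore] -/
theorem fin_four_cycle (a b c d : Fin 4) (hab : a ≠ b) (hac : a ≠ c) (had : a ≠ d) (hbc : b ≠ c)
    (hbd : b ≠ d) (hcd : c ≠ d) (h1 : c ≠ a + 1) (h2 : a ≠ c + 1) (h3 : d ≠ b + 1)
    (h4 : b ≠ d + 1) :
    (b = a + 1 ∨ a = b + 1) ∧ (c = b + 1 ∨ b = c + 1) ∧ (d = c + 1 ∨ c = d + 1) ∧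
      (a = d + 1 ∨ d = a + 1) := by
  revert a b c d
  decide

/-- **No bonded 4-cycle among four separated directions (sorted form).**  With
`π/3 < g₀ ≤ g₁ < π/2`, `2 g₀ ≤ π`, `g₁ < 2 g₀`: sorted angles `t₀ < ⋯ < t₃` in `(−π, π]`, pairwise
`cos (t i − t j) ≤ cos g₀`, and an injective relabelling `p : Fin 4 → Fin 4` such that the pairs
`{p⁻¹ k, p⁻¹ (k+1)}` are bonded — stated as: whenever `p b = p a + 1`, `cos g₁ ≤ cos (t b − t a)` —
do not exist. [folklore] -/
theorem four_sorted_cycle_false {g₀ g₁ : ℝ} (hg₀ : π / 3 < g₀) (hg₀₁ : g₀ ≤ g₁) (hg₁ : g₁ < π / 2)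
    (h2g₀ : 2 * g₀ ≤ π) (hg₁₀ : g₁ < 2 * g₀) (t : Fin 4 → ℝ) (hmono : StrictMono t)
    (hlo : -π < t 0) (hhi : t 3 ≤ π) (hsep : ∀ i j, i ≠ j → cos (t i - t j) ≤ cos g₀)
    (p : Fin 4 → Fin 4) (hp : Function.Injective p)
    (hbond : ∀ a b, p b = p a + 1 → cos g₁ ≤ cos (t b - t a)) : False := by
  have hπ := pi_pos
  obtain ⟨g1lo, g2lo, g3lo, g30hi, hd02, hd13⟩ := four_sorted_gaps hg₀ h2g₀ t hmono hlo hhi hsep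
  have h01 : t 0 < t 1 := hmono (by decide)
  have h12 : t 1 < t 2 := hmono (by decide)
  have h23 : t 2 < t 3 := hmono (by decide)
  have hg₁0 : 0 ≤ g₁ := by linarith
  -- `cos (2 g₀) < cos g₁`, so the diagonals are not bonded
  have hcos2 : cos (2 * g₀) < cos g₁ :=
    cos_lt_cos_of_nonneg_of_le_pi hg₁0 h2g₀ hg₁₀
  have nb02 : ¬ cos g₁ ≤ cos (t 2 - t 0) := fun h => by linarith
  have nb20 : ¬ cos g₁ ≤ cos (t 0 - t 2) := fun h => by rw [cos_sub_rev] at h; linarith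
  have nb13 : ¬ cos g₁ ≤ cos (t 3 - t 1) := fun h => by linarith
  have nb31 : ¬ cos g₁ ≤ cos (t 1 - t 3) := fun h => by rw [cos_sub_rev] at h; linarith
  have h1 : p 2 ≠ p 0 + 1 := fun h => nb02 (hbond 0 2 h)
  have h2 : p 0 ≠ p 2 + 1 := fun h => nb20 (hbond 2 0 h)
  have h3 : p 3 ≠ p 1 + 1 := fun h => nb13 (hbond 1 3 h)
  have h4 : p 1 ≠ p 3 + 1 := fun h => nb31 (hbond 3 1 h)
  obtain ⟨c01, c12, c23, c30⟩ := fin_four_cycle (p 0) (p 1) (p 2) (p 3)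
    (hp.ne (by decide)) (hp.ne (by decide)) (hp.ne (by decide)) (hp.ne (by decide))
    (hp.ne (by decide)) (hp.ne (by decide)) h1 h2 h3 h4
  -- each sorted-adjacent pair is bonded, hence its gap is `≤ g₁`
  have gap_le : ∀ x : ℝ, x ≤ π → cos g₁ ≤ cos x → x ≤ g₁ := fun x hxπ h =>
    le_of_cos_le_cos' hxπ hg₁0 h
  have hπ3 : 2 * π - 3 * g₀ < π := by linarith
  have b01 : t 1 - t 0 ≤ g₁ := by
    have hc : cos g₁ ≤ cos (t 1 - t 0) := by
      rcases c01 with h | h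
      · exact hbond 0 1 h
      · have := hbond 1 0 h; rwa [cos_sub_rev] at this
    exact gap_le _ (by linarith) hc
  have b12 : t 2 - t 1 ≤ g₁ := by
    have hc : cos g₁ ≤ cos (t 2 - t 1) := by
      rcases c12 with h | h
      · exact hbond 1 2 h
      · have := hbond 2 1 h; rwa [cos_sub_rev] at this
    exact gap_le _ (by linarith) hc
  have b23 : t 3 - t 2 ≤ g₁ := by
    have hc : cos g₁ ≤ cos (t 3 - t 2) := by
      rcases c23 with h | h
      · exact hbond 2 3 h
      · have := hbond 3 2 h; rwa [cos_sub_rev] at this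
    exact gap_le _ (by linarith) hc
  have b30 : 2 * π - (t 3 - t 0) ≤ g₁ := by
    have hc : cos g₁ ≤ cos (2 * π - (t 3 - t 0)) := by
      rw [cos_two_pi_sub]
      rcases c30 with h | h
      · have := hbond 3 0 h; rwa [cos_sub_rev] at this
      · exact hbond 0 3 h
    exact gap_le _ (by linarith) hc
  -- the four gaps sum to `2π ≤ 4 g₁ < 2π`
  linarith

/-- **No bonded 4-cycle among four separated directions.**  Four angles `θ k ∈ (−π, π]`,
pairwise separated (`cos (θ i − θ j) ≤ cos g₀` for `i ≠ j`), with the cyclic steps bonded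
(`cos g₁ ≤ cos (θ (k+1) − θ k)` for all `k : Fin 4`), do not exist when
`π/3 < g₀ ≤ g₁ < π/2`, `2 g₀ ≤ π`, `g₁ < 2 g₀`.  (Sort the angles and apply
`four_sorted_cycle_false`.) [folklore] -/
theorem four_cycle_false {g₀ g₁ : ℝ} (hg₀ : π / 3 < g₀) (hg₀₁ : g₀ ≤ g₁) (hg₁ : g₁ < π / 2)
    (h2g₀ : 2 * g₀ ≤ π) (hg₁₀ : g₁ < 2 * g₀) (θ : Fin 4 → ℝ) (hθ : ∀ k, -π < θ k ∧ θ k ≤ π)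
    (hsep : ∀ i j, i ≠ j → cos (θ i - θ j) ≤ cos g₀)
    (hbond : ∀ k : Fin 4, cos g₁ ≤ cos (θ (k + 1) - θ k)) : False := by
  -- the angles are pairwise distinct
  have hcos1 : cos g₀ < 1 := by
    have := cos_lt_cos_of_nonneg_of_le_pi (le_refl 0) (by linarith) (by linarith : (0 : ℝ) < g₀)
    rwa [cos_zero] at this
  have hθinj : Function.Injective θ := by
    intro i j hij
    by_contra hne
    have := hsep i j hne
    rw [hij, sub_self, cos_zero] at this
    linarith
  -- sort
  have hAcard : (Finset.univ.image θ).card = 4 := by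
    rw [Finset.card_image_of_injective _ hθinj, Finset.card_univ, Fintype.card_fin]
  let e := (Finset.univ.image θ).orderEmbOfFin hAcard
  have hmem : ∀ k, ∃ i, θ i = e k := by
    intro k
    have := (Finset.univ.image θ).orderEmbOfFin_mem hAcard k
    rw [Finset.mem_image] at this
    obtain ⟨i, -, hi⟩ := this
    exact ⟨i, hi⟩
  choose p hp using hmem
  have hpinj : Function.Injective p := by
    intro a b hab
    apply e.injective
    rw [← hp a, ← hp b, hab]
  refine four_sorted_cycle_false hg₀ hg₀₁ hg₁ h2g₀ hg₁₀ (fun k => e k) e.strictMono ?_ ?_ ?_ p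
    hpinj ?_
  · show -π < e 0
    rw [← hp 0]; exact (hθ _).1
  · show e 3 ≤ π
    rw [← hp 3]; exact (hθ _).2
  · intro i j hij
    have hne : p i ≠ p j := fun h => hij (hpinj h)
    rw [← hp i, ← hp j]
    exact hsep _ _ hne
  · intro a b hab
    rw [← hp a, ← hp b, hab]
    exact hbond (p a)

/-! ### From the sphere to the circle

A site direction `v ∈ S²` and four neighbour directions `w k ∈ S²` with `cb ≤ ⟪v, w k⟫ ≤ ca`
(bonded to the site), pairwise `⟪w i, w j⟫ ≤ ca` (separated) and cyclically `cb ≤ ⟪w k, w (k+1)⟫`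
(bonded to each other): in an orthonormal frame with third vector `v` the tangent parts have
polar angles `θ k` with `cos (θ i − θ j) ≤ σ₁ := (ca − cb²)/(1 − ca²)` and, for the bonded pairs,
`≥ γ₁ := (cb − ca²)/(1 − cb²)`; `four_cycle_false` applies with `g₀ = arccos σ₁`,
`g₁ = arccos γ₁`.  At `η = 1/100`: `ca = 1 − 1/(2·1.01²)`, `cb = 1 − 1.01²/2`, `σ₁ = 0.3646`
(`68.6°`), `γ₁ = 0.3026` (`72.4°`). -/

open RealInnerProductSpace

/-- An orthonormal basis of `ℝ³` whose third vector is the unit vector `v`. [folklore] -/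
theorem exists_orthonormalBasis_third_eq_unit {v : EuclideanSpace ℝ (Fin 3)} (hv : ‖v‖ = 1) :
    ∃ b : OrthonormalBasis (Fin 3) ℝ (EuclideanSpace ℝ (Fin 3)), b 2 = v := by
  have h2 : ‖(2 : ℝ) • v‖ = 2 := by rw [norm_smul, hv]; norm_num
  obtain ⟨b, hb⟩ := Literature.Geometry.DiscreteGeometry.exists_orthonormalBasis_third_eq h2
  refine ⟨b, ?_⟩
  rw [hb, smul_smul]; norm_num

/-- **Polar form in the tangent plane** (general radius): with `ρ = ‖X + iY‖`,
`X = ρ cos θ`, `Y = ρ sin θ` for `θ = arg (X + iY)`, and `ρ² = X² + Y²`. [folklore] -/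
theorem polar_form (X Y : ℝ) :
    X = ‖(⟨X, Y⟩ : ℂ)‖ * cos (Complex.arg ⟨X, Y⟩) ∧ Y = ‖(⟨X, Y⟩ : ℂ)‖ * sin (Complex.arg ⟨X, Y⟩) ∧
      ‖(⟨X, Y⟩ : ℂ)‖ ^ 2 = X ^ 2 + Y ^ 2 := by
  refine ⟨(Complex.norm_mul_cos_arg ⟨X, Y⟩).symm, (Complex.norm_mul_sin_arg ⟨X, Y⟩).symm, ?_⟩
  rw [Complex.sq_norm, Complex.normSq_mk]; ring

/-- **No site has a bonded 4-cycle of neighbours** (unit-vector form).  Let `0 ≤ cb ≤ ca < 1`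
with `ca² < cb`, and put `σ₁ = (ca − cb²)/(1 − ca²)`, `γ₁ = (cb − ca²)/(1 − cb²)`; assume
`γ₁ ≤ σ₁ < 1/2` (then `0 < γ₁` and `arccos γ₁ < π/2 < 2 arccos σ₁`).  Then there are no unit vectors `v, w₀, …, w₃` of `ℝ³`
with `cb ≤ ⟪v, w k⟫ ≤ ca`, `⟪w i, w j⟫ ≤ ca` (`i ≠ j`) and `cb ≤ ⟪w k, w (k+1)⟫` for all `k`
(indices mod 4).  [folklore] -/
theorem no_bonded_four_cycle {ca cb : ℝ} (hcb0 : 0 ≤ cb) (hcba : cb ≤ ca) (hca1 : ca < 1)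
    (hsq : ca ^ 2 < cb)
    (hγσ : (cb - ca ^ 2) / (1 - cb ^ 2) ≤ (ca - cb ^ 2) / (1 - ca ^ 2))
    (hσ : (ca - cb ^ 2) / (1 - ca ^ 2) < 1 / 2)
    {v : EuclideanSpace ℝ (Fin 3)} (hv : ‖v‖ = 1) (w : Fin 4 → EuclideanSpace ℝ (Fin 3))
    (hw : ∀ k, ‖w k‖ = 1) (hvw : ∀ k, cb ≤ ⟪v, w k⟫ ∧ ⟪v, w k⟫ ≤ ca)
    (hsep : ∀ i j, i ≠ j → ⟪w i, w j⟫ ≤ ca) (hcyc : ∀ k : Fin 4, cb ≤ ⟪w k, w (k + 1)⟫) :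
    False := by
  set σ₁ := (ca - cb ^ 2) / (1 - ca ^ 2) with hσ₁
  set γ₁ := (cb - ca ^ 2) / (1 - cb ^ 2) with hγ₁
  have hca0 : 0 ≤ ca := hcb0.trans hcba
  have hcb1 : cb < 1 := hcba.trans_lt hca1
  have h1ca : 0 < 1 - ca ^ 2 := by nlinarith
  have h1cb : 0 < 1 - cb ^ 2 := by nlinarith
  have hγ0 : 0 < γ₁ := div_pos (by linarith) h1cb
  have hσ0 : 0 ≤ σ₁ := div_nonneg (by nlinarith) h1ca.le
  -- tangent coordinates
  obtain ⟨b, hb⟩ := exists_orthonormalBasis_third_eq_unit hv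
  set X : Fin 4 → ℝ := fun k => ⟪b 0, w k⟫ with hXdef
  set Y : Fin 4 → ℝ := fun k => ⟪b 1, w k⟫ with hYdef
  set c : Fin 4 → ℝ := fun k => ⟪v, w k⟫ with hcdef
  have hZ : ∀ k, ⟪b 2, w k⟫ = c k := fun k => by simp only [hcdef, hb]
  have hXY : ∀ k, X k ^ 2 + Y k ^ 2 = 1 - c k ^ 2 := by
    intro k
    have h4 : ⟪w k, w k⟫ = 1 := by rw [real_inner_self_eq_norm_sq, hw k]; norm_num
    rw [Literature.Geometry.DiscreteGeometry.inner_eq_sum_three b, hZ k] at h4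
    simp only [hXdef, hYdef]
    nlinarith [h4]
  set ρ : Fin 4 → ℝ := fun k => ‖(⟨X k, Y k⟩ : ℂ)‖ with hρdef
  set θ : Fin 4 → ℝ := fun k => Complex.arg ⟨X k, Y k⟩ with hθdef
  have hρ0 : ∀ k, 0 ≤ ρ k := fun k => norm_nonneg _
  have hρsq : ∀ k, ρ k ^ 2 = 1 - c k ^ 2 := fun k => by
    rw [← hXY k]; exact (polar_form (X k) (Y k)).2.2
  -- the tangent cosine identity `XX' + YY' = ρ ρ' cos (θ - θ')`
  have hcos : ∀ i j, X i * X j + Y i * Y j = ρ i * ρ j * cos (θ i - θ j) := by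
    intro i j
    have hXi : X i = ρ i * cos (θ i) := (polar_form (X i) (Y i)).1
    have hYi : Y i = ρ i * sin (θ i) := (polar_form (X i) (Y i)).2.1
    have hXj : X j = ρ j * cos (θ j) := (polar_form (X j) (Y j)).1
    have hYj : Y j = ρ j * sin (θ j) := (polar_form (X j) (Y j)).2.1
    rw [cos_sub]
    linear_combination X j * hXi + ρ i * cos (θ i) * hXj + Y j * hYi + ρ i * sin (θ i) * hYj
  have hinner : ∀ i j, ⟪w i, w j⟫ = ρ i * ρ j * cos (θ i - θ j) + c i * c j := by
    intro i j
    rw [Literature.Geometry.DiscreteGeometry.inner_eq_sum_three b, hZ i, hZ j, ← hcos i j]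
  -- bounds on `ρ i ρ j`
  have hcb_le : ∀ k, cb ≤ c k := fun k => (hvw k).1
  have hc_le : ∀ k, c k ≤ ca := fun k => (hvw k).2
  have hc0 : ∀ k, 0 ≤ c k := fun k => hcb0.trans (hcb_le k)
  have hρρlo : ∀ i j, 1 - ca ^ 2 ≤ ρ i * ρ j := by
    intro i j
    have hi : 1 - ca ^ 2 ≤ ρ i ^ 2 := by
      rw [hρsq]; nlinarith [hc_le i, hc0 i]
    have hj : 1 - ca ^ 2 ≤ ρ j ^ 2 := by
      rw [hρsq]; nlinarith [hc_le j, hc0 j]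
    have hsq2 : (1 - ca ^ 2) ^ 2 ≤ (ρ i * ρ j) ^ 2 := by
      rw [mul_pow, sq (1 - ca ^ 2)]; exact mul_le_mul hi hj h1ca.le (sq_nonneg _)
    exact (pow_le_pow_iff_left₀ h1ca.le (mul_nonneg (hρ0 i) (hρ0 j)) two_ne_zero).1 hsq2
  have hρρhi : ∀ i j, ρ i * ρ j ≤ 1 - cb ^ 2 := by
    intro i j
    have hi : ρ i ^ 2 ≤ 1 - cb ^ 2 := by
      rw [hρsq]; nlinarith [hcb_le i, hcb0]
    have hj : ρ j ^ 2 ≤ 1 - cb ^ 2 := by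
      rw [hρsq]; nlinarith [hcb_le j, hcb0]
    have hsq2 : (ρ i * ρ j) ^ 2 ≤ (1 - cb ^ 2) ^ 2 := by
      rw [mul_pow, sq (1 - cb ^ 2)]; exact mul_le_mul hi hj (sq_nonneg _) h1cb.le
    exact (pow_le_pow_iff_left₀ (mul_nonneg (hρ0 i) (hρ0 j)) h1cb.le two_ne_zero).1 hsq2
  -- separation in the tangent circle: `cos (θ i - θ j) ≤ σ₁`
  have hsepθ : ∀ i j, i ≠ j → cos (θ i - θ j) ≤ σ₁ := by
    intro i j hij
    have h := hsep i j hij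
    rw [hinner] at h
    have hcc : cb ^ 2 ≤ c i * c j := by nlinarith [hcb_le i, hcb_le j, hcb0]
    have hK : ρ i * ρ j * cos (θ i - θ j) ≤ ca - cb ^ 2 := by linarith
    rcases le_or_gt (cos (θ i - θ j)) 0 with hneg | hpos
    · exact hneg.trans hσ0
    · rw [hσ₁, le_div_iff₀ h1ca]
      calc cos (θ i - θ j) * (1 - ca ^ 2) ≤ cos (θ i - θ j) * (ρ i * ρ j) :=
            mul_le_mul_of_nonneg_left (hρρlo i j) hpos.le
        _ ≤ ca - cb ^ 2 := by linarith
  -- bonds in the tangent circle: `γ₁ ≤ cos (θ (k+1) - θ k)`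
  have hbondθ : ∀ k : Fin 4, γ₁ ≤ cos (θ (k + 1) - θ k) := by
    intro k
    have h := hcyc k
    rw [hinner, cos_sub_rev] at h
    have hcc : c k * c (k + 1) ≤ ca ^ 2 := by
      nlinarith [hc_le k, hc_le (k + 1), hc0 k, hc0 (k + 1)]
    have hK : cb - ca ^ 2 ≤ ρ k * ρ (k + 1) * cos (θ (k + 1) - θ k) := by linarith
    have hpos : 0 < cos (θ (k + 1) - θ k) := by
      by_contra hle
      push Not at hle
      have : ρ k * ρ (k + 1) * cos (θ (k + 1) - θ k) ≤ 0 :=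
        mul_nonpos_of_nonneg_of_nonpos (mul_nonneg (hρ0 _) (hρ0 _)) hle
      linarith
    rw [hγ₁, div_le_iff₀ h1cb]
    calc cb - ca ^ 2 ≤ ρ k * ρ (k + 1) * cos (θ (k + 1) - θ k) := hK
      _ ≤ (1 - cb ^ 2) * cos (θ (k + 1) - θ k) :=
          mul_le_mul_of_nonneg_right (hρρhi _ _) hpos.le
      _ = cos (θ (k + 1) - θ k) * (1 - cb ^ 2) := by ring
  -- the angles
  set g₀ := arccos σ₁ with hg₀
  set g₁ := arccos γ₁ with hg₁
  have hσ1 : σ₁ ≤ 1 := by linarith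
  have hγ1 : γ₁ ≤ 1 := hγσ.trans hσ1
  have hcg₀ : cos g₀ = σ₁ := cos_arccos (by linarith) hσ1
  have hcg₁ : cos g₁ = γ₁ := cos_arccos (by linarith) hγ1
  have hπ3 : π / 3 < g₀ := by
    have : arccos (1 / 2) = π / 3 :=
      arccos_eq_of_eq_cos (by positivity) (by linarith [pi_pos]) cos_pi_div_three.symm
    rw [hg₀, ← this]
    exact arccos_lt_arccos (by linarith) hσ (by norm_num)
  have hg₀₁ : g₀ ≤ g₁ := arccos_le_arccos hγσ
  have hg₁2 : g₁ < π / 2 := arccos_lt_pi_div_two.2 hγ0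
  have h2g₀ : 2 * g₀ ≤ π := by
    have := arccos_le_pi_div_two.2 hσ0
    rw [← hg₀] at this; linarith
  have hg₁₀ : g₁ < 2 * g₀ := by linarith
  refine four_cycle_false hπ3 hg₀₁ hg₁2 h2g₀ hg₁₀ θ (fun k => ⟨Complex.neg_pi_lt_arg _,
    Complex.arg_le_pi _⟩) (fun i j hij => ?_) (fun k => ?_)
  · rw [hcg₀]; exact hsepθ i j hij
  · rw [hcg₁]; exact hbondθ k

/-- **The `η = 1/100` instance.**  With `ca = 1 − 1/(2·(101/100)²)` and `cb = 1 − (101/100)²/2`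
(the angular window of `softFourRings_of_twelve_unit`: `inner_le_of_link`, `le_inner_of_bond`), no
site direction has four neighbour directions bonded in a 4-cycle. [folklore] -/
theorem no_bonded_four_cycle_one_percent {v : EuclideanSpace ℝ (Fin 3)} (hv : ‖v‖ = 1)
    (w : Fin 4 → EuclideanSpace ℝ (Fin 3)) (hw : ∀ k, ‖w k‖ = 1)
    (hvw : ∀ k, (1 - (101 / 100 : ℝ) ^ 2 / 2) ≤ ⟪v, w k⟫ ∧
      ⟪v, w k⟫ ≤ 1 - 1 / (2 * (101 / 100 : ℝ) ^ 2))
    (hsep : ∀ i j, i ≠ j → ⟪w i, w j⟫ ≤ 1 - 1 / (2 * (101 / 100 : ℝ) ^ 2))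
    (hcyc : ∀ k : Fin 4, (1 - (101 / 100 : ℝ) ^ 2 / 2) ≤ ⟪w k, w (k + 1)⟫) : False :=
  no_bonded_four_cycle (ca := 1 - 1 / (2 * (101 / 100 : ℝ) ^ 2))
    (cb := 1 - (101 / 100 : ℝ) ^ 2 / 2) (by norm_num) (by norm_num) (by norm_num) (by norm_num)
    (by norm_num) (by norm_num) hv w hw hvw hsep hcyc

end Summit.AtomisticToContinuum.Crystallization.Theorems
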